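import Literature.MathematicalPhysics.KineticTheory.SiteChainFokkerPlanckApproximation
import Literature.MathematicalPhysics.KineticTheory.SiteChainDualityDuhamel
import HarnessLib

/-!
# Fokker–Planck identification for site-inhomogeneous chains, VI: weakly stationary densities are invariant

Topic `Literature/MathematicalPhysics/KineticTheory`, grouping namespace `…KineticTheory.HeatConduction`.
**The Fokker–Planck identification** for a uniformly confining site-dependent chain `P : SiteChain`
(`SiteChain.UniformlyConfining`, `N ≥ 1`, `T_L, T_R ≥ 0`) whose energy sublevel sets have
polynomially growing volume: a `C²` integrable `ρ ≥ 0` solving the stationary Fokker–Planck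
equation `L̂ρ + 2γρ = 0` pointwise defines an INVARIANT measure `ρ dx` of the Langevin transition
kernels `P_t = P.langevinKernel N T_L T_R t`: `(ρ dx).bind P_t = ρ dx` for all `t ≥ 0`
(`withDensity_bind_langevinKernel_of_revGenerator`). Proof (Cuneo–Eckmann–Hairer–Rey-Bellet 2018
§3.1, made quantitative): Lebesgue duality `dx P_t(x,dy) = e^{2γt} dy P̂_t(y,dx)`
(`SiteChainReversal.lean`) turns `(ρ dx)P_t(A)` into `e^{2γt} ∫_A P̂_t ρ`; for the truncations
`f_n ∈ C²_c` (`0 ≤ f_n ≤ ρ`, `f_n → ρ`, defect `‖L̂f_n + 2γf_n‖₁ → 0`,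
`SiteChainFokkerPlanckApproximation.lean`) the integrated Duhamel bound
(`SiteChainDualityDuhamel.lean`) gives `∫ |e^{2γt} P̂_t f_n - f_n| dy → 0`, and Fatou's lemma
(twice) yields `e^{2γt} ∫_A P̂_t ρ ≤ ∫_A ρ`, i.e. `(ρ dx) P_t ≤ ρ dx` setwise
(`setLIntegral_revKernel_density_le`, `lintegral_density_mul_langevinKernel_le`); equality follows
from conservation of mass. Twin of `Summits/…/EmbeddedDrudeMourreNessUnique.lean` (the generic
part) for site-dependent data; combined with a smooth-density theorem (Hörmander) and the
integration by parts `revGenerator_add_eq_zero_of_weak` it identifies weak steady states with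
invariant probability measures of the semigroup.

## References

* N. Cuneo, J.-P. Eckmann, M. Hairer, L. Rey-Bellet, *Non-equilibrium steady states for networks of
  oscillators*, Electron. J. Probab. **23** (2018) no. 55, Thm 2.13 and §3.1.
-/

noncomputable section

open MeasureTheory ProbabilityTheory Filter Topology Set
open scoped NNReal ENNReal ContDiff

namespace Literature.MathematicalPhysics.KineticTheory.HeatConduction

open Literature.MathematicalPhysics.KineticTheory Literature.Probability.Process

variable {N : ℕ} {P : SiteChain}

namespace SiteChain.UniformlyConfining

variable (hP : P.UniformlyConfining) (hN : 0 < N) {T_L T_R : ℝ} (hTL : 0 ≤ T_L) (hTR : 0 ≤ T_R)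
  {ρ : PhaseSpace N → ℝ} (hρ : ContDiff ℝ 2 ρ) (hρ0 : ∀ x, 0 ≤ ρ x) (hρi : Integrable ρ)
  (hpde : ∀ x, sdeGenerator (fun y => -P.langevinDrift N y) (P.noiseVecL N T_L) (P.noiseVecR N T_R) ρ x +
    2 * P.γ * ρ x = 0)
  (hvol : ∃ (C : ℝ) (d : ℕ), 0 ≤ C ∧ ∀ R : ℝ, 1 ≤ R →
    (volume {x : PhaseSpace N | P.hamiltonian N x ≤ 4 * R}).toReal ≤ C * R ^ d)
include hP hN hTL hTR hρ hρ0 hρi hpde hvol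

/-- **Setwise sub-eigenvalue bound for the reversed kernels** (site-dependent chain): for `t > 0`
and every set `A`, `∫_A (∫ ρ dP̂_t(y,·)) dy ≤ e^{-2γt} ∫_A ρ` (truncations, integrated Duhamel bound,
Fatou twice). [folklore] -/
theorem setLIntegral_revKernel_density_le {t : ℝ≥0} (ht : 0 < t) (A : Set (PhaseSpace N)) :
    ∫⁻ y in A, ∫⁻ x, ENNReal.ofReal (ρ x) ∂(P.langevinRevKernel N T_L T_R t y) ≤
      ENNReal.ofReal (Real.exp (-(2 * P.γ) * t)) * ∫⁻ y in A, ENNReal.ofReal (ρ y) := by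
  set κ := P.langevinRevKernel N T_L T_R with hκ
  haveI hprob : ∀ s z, IsProbabilityMeasure (κ s z) := fun s z =>
    hP.isProbabilityMeasure_langevinRevKernel N T_L T_R s z
  set c := 2 * P.γ with hc
  have hU2 := hP.contDiff_U
  have hV2 := hP.contDiff_V
  have hct : 0 ≤ c * t := by have := hP.γ_nonneg; have := t.coe_nonneg; positivity
  have hρc : Continuous ρ := hρ.continuous
  have hρm : Measurable fun x => ENNReal.ofReal (ρ x) := hρc.measurable.ennreal_ofReal
  -- the truncations
  have hex : ∀ n : ℕ, ∃ M R : ℝ, (n : ℝ) ≤ M ∧ (n : ℝ) ≤ R ∧ 0 < M ∧ 1 ≤ R ∧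
      ∫ x, |sdeGenerator (fun y => -P.langevinDrift N y) (P.noiseVecL N T_L) (P.noiseVecR N T_R)
            (fun y => smoothCutoff (P.hamiltonian N y / R) * (M * linCutoff (ρ y / M))) x +
          2 * P.γ * (smoothCutoff (P.hamiltonian N x / R) * (M * linCutoff (ρ x / M)))| ≤
        1 / ((n : ℝ) + 1) := fun n =>
    hP.exists_truncation_defect_le hN hTL hTR hρ hρ0 hρi hpde hvol (by positivity) n n
  choose M R hMn hRn hM0 hR1 hdef using hex
  set f : ℕ → PhaseSpace N → ℝ := fun n y =>
    smoothCutoff (P.hamiltonian N y / R n) * (M n * linCutoff (ρ y / M n)) with hf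
  have hf2 : ∀ n, ContDiff ℝ 2 (f n) := fun n => contDiff_truncation hU2 hV2 hρ (M n) (R n)
  have hfc : ∀ n, HasCompactSupport (f n) := fun n =>
    hP.hasCompactSupport_truncation (M n) (by linarith [hR1 n])
  have hfI : ∀ n x, f n x ∈ Icc 0 (ρ x) := fun n x => truncation_mem_Icc hρ0 (hM0 n) (R n) x
  have hflim : ∀ x, Tendsto (fun n => f n x) atTop (𝓝 (ρ x)) := by
    intro x
    refine tendsto_const_nhds.congr' ?_
    obtain ⟨n₀, hn₀⟩ := exists_nat_ge (max (P.hamiltonian N x) (ρ x))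
    filter_upwards [eventually_ge_atTop n₀] with n hn
    have hn' : (n₀ : ℝ) ≤ n := by exact_mod_cast hn
    have h1 : P.hamiltonian N x ≤ R n := by linarith [le_max_left (P.hamiltonian N x) (ρ x), hRn n]
    have h2 : ρ x ≤ M n := by linarith [le_max_right (P.hamiltonian N x) (ρ x), hMn n]
    simp only [hf]
    rw [P.energyCutoff_eq_one (by linarith [hR1 n]) h1, heightCutoff_eq_self (hM0 n) h2, one_mul]
  have hfm : ∀ n, Measurable fun x => ENNReal.ofReal (f n x) := fun n =>
    (hf2 n).continuous.measurable.ennreal_ofReal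
  -- the integrated Duhamel errors tend to zero
  set D : ℕ → ℝ≥0∞ := fun n => ∫⁻ y, ENNReal.ofReal |Real.exp (c * t) * ∫ x, f n x ∂(κ t y) - f n y| with hD
  have hDle : ∀ n, D n ≤ ENNReal.ofReal (Real.exp (c * t)) * t * ENNReal.ofReal (1 / ((n:ℝ) + 1)) := by
    intro n
    refine (hP.lintegral_abs_duhamel_le T_L T_R hN (hf2 n) (hfc n) t).trans ?_
    refine mul_le_mul_right ?_ _
    have hEc : Continuous fun x => |sdeGenerator (fun z => -P.langevinDrift N z) (P.noiseVecL N T_L)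
        (P.noiseVecR N T_R) (f n) x + 2 * P.γ * f n x| :=
      ((continuous_sdeGenerator _ _ (P.contDiff_one_langevinDrift hU2 hV2 N).continuous.neg (hf2 n)).add
        (continuous_const.mul (hf2 n).continuous)).abs
    have hEi : Integrable fun x => |sdeGenerator (fun z => -P.langevinDrift N z) (P.noiseVecL N T_L)
        (P.noiseVecR N T_R) (f n) x + 2 * P.γ * f n x| :=
      hEc.integrable_of_hasCompactSupport
        ((hasCompactSupport_sdeGenerator _ _ (hfc n)).add ((hfc n).mul_left)).abs
    rw [← ofReal_integral_eq_lintegral_ofReal hEi (Eventually.of_forall fun x => abs_nonneg _)]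
    exact ENNReal.ofReal_le_ofReal (hdef n)
  have hDlim : Tendsto D atTop (𝓝 0) := by
    have h0 : Tendsto (fun n : ℕ => ENNReal.ofReal (1 / ((n:ℝ) + 1))) atTop (𝓝 0) := by
      rw [← ENNReal.ofReal_zero]
      exact ENNReal.tendsto_ofReal tendsto_one_div_add_atTop_nhds_zero_nat
    have h1 : Tendsto (fun n : ℕ => ENNReal.ofReal (Real.exp (c * t)) * t * ENNReal.ofReal (1 / ((n:ℝ) + 1)))
        atTop (𝓝 0) := by
      have := ENNReal.Tendsto.const_mul (a := ENNReal.ofReal (Real.exp (c * t)) * (t : ℝ≥0∞)) h0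
        (Or.inr (ENNReal.mul_ne_top ENNReal.ofReal_ne_top ENNReal.coe_ne_top))
      rwa [mul_zero] at this
    exact tendsto_of_tendsto_of_tendsto_of_le_of_le tendsto_const_nhds h1 (fun n => bot_le) hDle
  -- notation for the transported functions
  set g : PhaseSpace N → ℝ≥0∞ := fun y => ∫⁻ x, ENNReal.ofReal (ρ x) ∂(κ t y) with hg
  set gn : ℕ → PhaseSpace N → ℝ≥0∞ := fun n y => ∫⁻ x, ENNReal.ofReal (f n x) ∂(κ t y) with hgn
  have hmeas_t : ∀ {h : PhaseSpace N → ℝ≥0∞}, Measurable h → Measurable fun y => ∫⁻ x, h x ∂(κ t y) := by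
    intro h hh
    have h1 := hP.measurable_lintegral_langevinRevKernel N T_L T_R hh
    have h2 : Measurable fun y : PhaseSpace N => (y, (t : ℝ)) := measurable_id.prodMk measurable_const
    have h3 := h1.comp h2
    simpa [Function.comp_def, Real.toNNReal_coe] using h3
  have hgn_meas : ∀ n, Measurable (gn n) := fun n => hmeas_t (hfm n)
  -- `gn = ofReal ∘ Φ_n` with the real transported truncation
  have hgn_eq : ∀ n y, gn n y = ENNReal.ofReal (∫ x, f n x ∂(κ t y)) := by
    intro n y
    obtain ⟨Cf, hCf⟩ := (hf2 n).continuous.bounded_above_of_compact_support (hfc n)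
    have hint : Integrable (f n) (κ t y) :=
      (integrable_const Cf).mono' (hf2 n).continuous.aestronglyMeasurable (Eventually.of_forall hCf)
    rw [hgn, ofReal_integral_eq_lintegral_ofReal hint (Eventually.of_forall fun x => (hfI n x).1)]
  -- pointwise: `Φ_n ≤ e^{-ct} (f_n + |e^{ct} Φ_n - f_n|)`
  have hpt : ∀ n y, gn n y ≤ ENNReal.ofReal (Real.exp (-c * t)) * ENNReal.ofReal (f n y) +
      ENNReal.ofReal (Real.exp (-c * t)) *
        ENNReal.ofReal |Real.exp (c * t) * ∫ x, f n x ∂(κ t y) - f n y| := by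
    intro n y
    rw [hgn_eq, ← mul_add, ← ENNReal.ofReal_add (hfI n y).1 (abs_nonneg _),
      ← ENNReal.ofReal_mul (Real.exp_pos _).le]
    refine ENNReal.ofReal_le_ofReal ?_
    set Φ := ∫ x, f n x ∂(κ t y)
    have hexp : Real.exp (-c * t) * Real.exp (c * t) = 1 := by rw [← Real.exp_add]; ring_nf; simp
    calc Φ = (Real.exp (-c * t) * Real.exp (c * t)) * Φ := by rw [hexp, one_mul]
      _ = Real.exp (-c * t) * (f n y + (Real.exp (c * t) * Φ - f n y)) := by ring
      _ ≤ Real.exp (-c * t) * (f n y + |Real.exp (c * t) * Φ - f n y|) :=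
          mul_le_mul_of_nonneg_left (add_le_add le_rfl (le_abs_self _)) (Real.exp_pos _).le
  -- integrate over `A`
  set J := ∫⁻ y in A, ENNReal.ofReal (ρ y) with hJ
  have hbound : ∀ n, ∫⁻ y in A, gn n y ≤ ENNReal.ofReal (Real.exp (-c * t)) * J +
      ENNReal.ofReal (Real.exp (-c * t)) * D n := by
    intro n
    have hm1 : Measurable fun y => ENNReal.ofReal (Real.exp (-c * t)) * ENNReal.ofReal (f n y) :=
      (hfm n).const_mul _
    calc ∫⁻ y in A, gn n y
        ≤ ∫⁻ y in A, (ENNReal.ofReal (Real.exp (-c * t)) * ENNReal.ofReal (f n y) +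
            ENNReal.ofReal (Real.exp (-c * t)) *
              ENNReal.ofReal |Real.exp (c * t) * ∫ x, f n x ∂(κ t y) - f n y|) := lintegral_mono (hpt n)
      _ = (ENNReal.ofReal (Real.exp (-c * t)) * ∫⁻ y in A, ENNReal.ofReal (f n y)) +
            ENNReal.ofReal (Real.exp (-c * t)) *
              ∫⁻ y in A, ENNReal.ofReal |Real.exp (c * t) * ∫ x, f n x ∂(κ t y) - f n y| := by
          rw [lintegral_add_left hm1, lintegral_const_mul _ (hfm n), lintegral_const_mul' _ _ ENNReal.ofReal_ne_top]
      _ ≤ ENNReal.ofReal (Real.exp (-c * t)) * J + ENNReal.ofReal (Real.exp (-c * t)) * D n := by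
          refine add_le_add (mul_le_mul_right (lintegral_mono fun y => ?_) _)
            (mul_le_mul_right (setLIntegral_le_lintegral A _) _)
          exact ENNReal.ofReal_le_ofReal (hfI n y).2
  -- Fatou, twice
  have hfatou1 : ∀ y, g y ≤ liminf (fun n => gn n y) atTop := by
    intro y
    have hlim : ∀ x, Tendsto (fun n => ENNReal.ofReal (f n x)) atTop (𝓝 (ENNReal.ofReal (ρ x))) := fun x =>
      ENNReal.tendsto_ofReal (hflim x)
    calc g y = ∫⁻ x, liminf (fun n => ENNReal.ofReal (f n x)) atTop ∂(κ t y) :=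
          lintegral_congr fun x => ((hlim x).liminf_eq).symm
      _ ≤ liminf (fun n => gn n y) atTop := lintegral_liminf_le hfm
  have hfatou2 : ∫⁻ y in A, g y ≤ liminf (fun n => ∫⁻ y in A, gn n y) atTop :=
    calc ∫⁻ y in A, g y ≤ ∫⁻ y in A, liminf (fun n => gn n y) atTop := lintegral_mono hfatou1
      _ ≤ liminf (fun n => ∫⁻ y in A, gn n y) atTop := lintegral_liminf_le hgn_meas
  -- the majorants converge
  have hBlim : Tendsto (fun n => ENNReal.ofReal (Real.exp (-c * t)) * J + ENNReal.ofReal (Real.exp (-c * t)) * D n)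
      atTop (𝓝 (ENNReal.ofReal (Real.exp (-c * t)) * J)) := by
    have h1 := ENNReal.Tendsto.const_mul (a := ENNReal.ofReal (Real.exp (-c * t))) hDlim (Or.inr ENNReal.ofReal_ne_top)
    rw [mul_zero] at h1
    have h2 := (tendsto_const_nhds (x := ENNReal.ofReal (Real.exp (-c * t)) * J)).add h1
    rwa [add_zero] at h2
  calc ∫⁻ y in A, g y ≤ liminf (fun n => ∫⁻ y in A, gn n y) atTop := hfatou2
    _ ≤ liminf (fun n => ENNReal.ofReal (Real.exp (-c * t)) * J + ENNReal.ofReal (Real.exp (-c * t)) * D n) atTop :=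
        liminf_le_liminf (Eventually.of_forall hbound)
    _ = ENNReal.ofReal (Real.exp (-c * t)) * J := hBlim.liminf_eq
    _ = ENNReal.ofReal (Real.exp (-(2 * P.γ) * t)) * J := by rw [hc, neg_mul]

/-- **Weakly stationary densities are sub-invariant, setwise** (site-dependent chain): for `t > 0`
and measurable `A`, `∫ ρ(x) P_t(x, A) dx ≤ ∫_A ρ` (duality + `setLIntegral_revKernel_density_le`).
[folklore] -/
theorem lintegral_density_mul_langevinKernel_le {t : ℝ≥0} (ht : 0 < t) {A : Set (PhaseSpace N)}
    (hA : MeasurableSet A) :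
    ∫⁻ x, ENNReal.ofReal (ρ x) * (P.langevinKernel N T_L T_R t x) A ≤ ∫⁻ x in A, ENNReal.ofReal (ρ x) := by
  have hρm : Measurable fun x => ENNReal.ofReal (ρ x) := hρ.continuous.measurable.ennreal_ofReal
  have h1m : Measurable (A.indicator fun _ : PhaseSpace N => (1:ℝ≥0∞)) := measurable_const.indicator hA
  set Hf : PhaseSpace N × PhaseSpace N → ℝ≥0∞ :=
    fun p => ENNReal.ofReal (ρ p.1) * A.indicator (fun _ => (1:ℝ≥0∞)) p.2 with hHf
  have hHm : Measurable Hf := (hρm.comp measurable_fst).mul (h1m.comp measurable_snd)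
  have hdual := hP.lintegral_langevinKernel_duality T_L T_R hN ht hHm
  have hL : ∀ x, ∫⁻ y, Hf (x, y) ∂(P.langevinKernel N T_L T_R t x) =
      ENNReal.ofReal (ρ x) * (P.langevinKernel N T_L T_R t x) A := by
    intro x
    simp only [hHf]
    rw [lintegral_const_mul _ h1m, lintegral_indicator_const hA, one_mul]
  have hR : ∀ y, ∫⁻ x, Hf (x, y) ∂(P.langevinRevKernel N T_L T_R t y) =
      A.indicator (fun _ => (1:ℝ≥0∞)) y * ∫⁻ x, ENNReal.ofReal (ρ x) ∂(P.langevinRevKernel N T_L T_R t y) := by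
    intro y
    simp only [hHf]
    rw [lintegral_mul_const _ hρm, mul_comm]
  simp_rw [hL, hR] at hdual
  rw [hdual]
  have hind : ∫⁻ y, A.indicator (fun _ => (1:ℝ≥0∞)) y *
      ∫⁻ x, ENNReal.ofReal (ρ x) ∂(P.langevinRevKernel N T_L T_R t y) =
      ∫⁻ y in A, ∫⁻ x, ENNReal.ofReal (ρ x) ∂(P.langevinRevKernel N T_L T_R t y) := by
    rw [← lintegral_indicator hA]
    refine lintegral_congr fun y => ?_
    by_cases hy : y ∈ A
    · simp [hy]
    · simp [hy]
  rw [hind]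
  calc ENNReal.ofReal (Real.exp (2 * P.γ * t)) *
        ∫⁻ y in A, ∫⁻ x, ENNReal.ofReal (ρ x) ∂(P.langevinRevKernel N T_L T_R t y)
      ≤ ENNReal.ofReal (Real.exp (2 * P.γ * t)) * (ENNReal.ofReal (Real.exp (-(2 * P.γ) * t)) *
          ∫⁻ y in A, ENNReal.ofReal (ρ y)) :=
        mul_le_mul_right (hP.setLIntegral_revKernel_density_le hN hTL hTR hρ hρ0 hρi hpde hvol ht A) _
    _ = ∫⁻ y in A, ENNReal.ofReal (ρ y) := by
        rw [← mul_assoc, ← ENNReal.ofReal_mul (Real.exp_pos _).le, ← Real.exp_add]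
        have : 2 * P.γ * (t:ℝ) + -(2 * P.γ) * t = 0 := by ring
        rw [this, Real.exp_zero, ENNReal.ofReal_one, one_mul]

/-- **A weakly stationary `C²` density is an invariant measure of the Langevin kernels of a
site-dependent chain**: `(ρ dx).bind P_t = ρ dx` for every `t ≥ 0` (setwise sub-invariance +
conservation of mass). [cite: CuneoEckmannHairerReyBellet2018, §3.1] -/
theorem withDensity_bind_langevinKernel_of_revGenerator (t : ℝ≥0) :
    (volume.withDensity fun x => ENNReal.ofReal (ρ x)).bind (P.langevinKernel N T_L T_R t) =
      volume.withDensity fun x => ENNReal.ofReal (ρ x) := by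
  set μ := volume.withDensity fun x => ENNReal.ofReal (ρ x) with hμ
  have hρm : Measurable fun x => ENNReal.ofReal (ρ x) := hρ.continuous.measurable.ennreal_ofReal
  haveI : IsFiniteMeasure μ := by
    refine ⟨?_⟩
    rw [hμ, withDensity_apply _ MeasurableSet.univ, Measure.restrict_univ,
      ← ofReal_integral_eq_lintegral_ofReal hρi (Eventually.of_forall hρ0)]
    exact ENNReal.ofReal_lt_top
  haveI : IsMarkovKernel (P.langevinKernel N T_L T_R t) := hP.isMarkovKernel_langevinKernel N T_L T_R t
  -- a finite measure dominated setwise by another measure of the same total mass equals it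
  have key : ∀ ν : Measure (PhaseSpace N), (∀ A, MeasurableSet A → ν A ≤ μ A) → ν Set.univ = μ Set.univ →
      ν = μ := by
    intro ν hle huniv
    refine Measure.ext fun A hA => le_antisymm (hle A hA) ?_
    have h1 := hle Aᶜ hA.compl
    have hν : ν A + ν Aᶜ = ν Set.univ := by rw [measure_add_measure_compl hA]
    have hμ' : μ A + μ Aᶜ = μ Set.univ := by rw [measure_add_measure_compl hA]
    have hfin : μ Aᶜ ≠ ⊤ := measure_ne_top μ _
    have h2 : μ A + μ Aᶜ ≤ ν A + μ Aᶜ := by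
      calc μ A + μ Aᶜ = ν A + ν Aᶜ := by rw [hμ', hν, huniv]
        _ ≤ ν A + μ Aᶜ := add_le_add le_rfl h1
    exact (ENNReal.add_le_add_iff_right hfin).1 h2
  rcases eq_or_lt_of_le (show (0:ℝ≥0) ≤ t from bot_le) with ht | ht
  · rw [← ht, hP.langevinKernel_zero N T_L T_R]
    have : (⇑(Kernel.id : Kernel (PhaseSpace N) (PhaseSpace N))) = Measure.dirac := funext fun x => Kernel.id_apply x
    rw [this, Measure.bind_dirac]
  · refine key _ (fun A hA => ?_) ?_
    · rw [Measure.bind_apply hA (Kernel.measurable _).aemeasurable,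
        lintegral_withDensity_eq_lintegral_mul₀ hρm.aemeasurable (Kernel.measurable_coe _ hA).aemeasurable,
        withDensity_apply _ hA]
      exact hP.lintegral_density_mul_langevinKernel_le hN hTL hTR hρ hρ0 hρi hpde hvol ht hA
    · rw [Measure.bind_apply MeasurableSet.univ (Kernel.measurable _).aemeasurable]
      simp

end SiteChain.UniformlyConfining

end Literature.MathematicalPhysics.KineticTheory.HeatConduction
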